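import Summits.ResolutionOfSingularities.ResolutionOfSingularities.Theorems.SyzygyFlatteningHigherRankTerminationSingIdealLocAt
import Literature.AlgebraicGeometry.Resolution.ProperModels
import Literature.AlgebraicGeometry.Resolution.RegularLocusOpen
import Literature.AlgebraicGeometry.Resolution.CanonicalResolutionProofs
import Mathlib.AlgebraicGeometry.Morphisms.Flat
import HarnessLib

/-!
# Restriction to a smaller affine open of a proper model — `stub_affineRes`

Crux `SyzygyFlattening.Globalisation` (stmt-ResolutionOfSingularities-17061), line `birth`,
registered stub `stub_affineRes`: for non-empty affine opens `V ⊆ U` of a proper model `M` of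
`K/k` (`ProperModel k K`, `Literature/…/ProperModels.lean`: `M.X` integral, proper over `Spec k`)
the restriction `res : Γ(M, U) → Γ(M, V)` is

1. injective (`M.X` is integral and `V ≠ ∅`: Mathlib `map_injective_of_isIntegral`);
2. flat (`res = (𝟙 M.X).appLE U V`, and `𝟙 M.X` is an open immersion, hence `Flat`, whose
   `appLE` between affine opens are flat ring maps: `Flat.flat_appLE`);
3. compatible with the ideals of the non-regular loci: `J(Γ(M,V)) = J(Γ(M,U)) · Γ(M,V)` where
   `J(R) = ⋂ {𝔭 | R_𝔭 not regular}` (inline, cf. `singIdeal`; = the vanishing ideal of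
   `Reg(R)ᶜ`, `affineRes_sInf_eq_vanishingIdeal`).

Proof of 3 (`affineRes_vanishingIdeal_eq_map`, pure algebra + `affineRes_isLocalization`):
ideal equality is tested after localising at the maximal ideals `𝔪` of `S = Γ(M, V)`
(`Ideal.eq_of_localization_maximal`). The local ring `S_𝔪` is the stalk of `M` at the
corresponding point `x ∈ V ⊆ U` (`IsAffineOpen.isLocalization_stalk'`), which is ALSO the
localisation of `R = Γ(M, U)` at `𝔭 = res⁻¹ 𝔪` (`IsAffineOpen.isLocalization_stalk`),
compatibly with `res` (`germ_res`). The non-regular loci of `R` and `S` are closed (the regular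
locus of a scheme locally of finite type over a field is open,
`isOpen_regularLocus_of_locallyOfFiniteType_field`, read on `Spec Γ(M, U) ↪ M`,
`fromSpec_preimage_regularLocus`), so by the landed
`vanishingIdeal_compl_regularLocus_of_isLocalization` (the ideal of the non-regular locus
localises, `…HigherRankTerminationSingIdealLocAt.lean`) both `J(S) S_𝔪` and
`(J(R) S) S_𝔪 = J(R) S_𝔪` equal `J(S_𝔪)`.

## References

* H. Matsumura, *Commutative Ring Theory*, CUP 1986, §30, Cor. to Thm. 30.5 (the regular locus
  of a finitely generated algebra over a field is open). [Matsumura1987]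
* R. Hartshorne, *Algebraic Geometry*, GTM 52, 1977, III Prop. 9.2 (open immersions are flat),
  II Ex. 8.1 (a) (regularity is a property of the local rings). [Hartshorne1977]
-/

noncomputable section

-- single-problem summit: the doubled namespace component `ResolutionOfSingularities` is forced
set_option linter.dupNamespace false

namespace Summit.ResolutionOfSingularities.ResolutionOfSingularities.Theorems.SyzygyFlattening

open CategoryTheory AlgebraicGeometry TopologicalSpace
open Literature.AlgebraicGeometry
open Literature.AlgebraicGeometry.Resolution

universe u

/-! ## Algebra: the ideal of the non-regular locus along a pointwise localisation -/

/-- The ideal `⋂ {𝔭 | R_𝔭 is not regular}` of the non-regular locus of a ring `R` is the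
vanishing ideal of the complement `Reg(R)ᶜ ⊆ Spec R` of the regular locus (unfolding; compare
`singIdeal_eq_vanishingIdeal`). [folklore] -/
theorem affineRes_sInf_eq_vanishingIdeal (R : Type u) [CommRing R] :
    sInf ((fun 𝔭 : PrimeSpectrum R => 𝔭.asIdeal) ''
        {𝔭 : PrimeSpectrum R | ¬ IsRegularLocalRing (Localization.AtPrime 𝔭.asIdeal)}) =
      PrimeSpectrum.vanishingIdeal (regularLocus R)ᶜ := by
  rw [sInf_image, PrimeSpectrum.vanishingIdeal]
  rfl

/-- **The ideal of the non-regular locus extends along a pointwise localisation.** Let `R → S`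
be a ring map such that every local ring `S_𝔪` (`𝔪` maximal) is, as an `R`-algebra, the
localisation of `R` at `𝔪 ∩ R` (e.g. an open immersion `Spec S ↪ Spec R`), and assume the
non-regular loci `Reg(R)ᶜ`, `Reg(S)ᶜ` are closed. Then the vanishing ideal of `Reg(S)ᶜ` is the
extension of that of `Reg(R)ᶜ`: both localise at every maximal `𝔪` to the vanishing ideal of
`Reg(S_𝔪)ᶜ` (`vanishingIdeal_compl_regularLocus_of_isLocalization`), and ideals agreeing at all
maximal ideals are equal. [folklore] -/
theorem affineRes_vanishingIdeal_eq_map {R S : Type u} [CommRing R] [CommRing S] [Algebra R S]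
    (hR : IsClosed (regularLocus R)ᶜ) (hS : IsClosed (regularLocus S)ᶜ)
    (hloc : ∀ (𝔪 : Ideal S) (_ : 𝔪.IsMaximal),
      IsLocalization (𝔪.comap (algebraMap R S)).primeCompl (Localization.AtPrime 𝔪)) :
    PrimeSpectrum.vanishingIdeal (regularLocus S)ᶜ =
      (PrimeSpectrum.vanishingIdeal (regularLocus R)ᶜ).map (algebraMap R S) := by
  apply Ideal.eq_of_localization_maximal
  intro 𝔪 h𝔪
  haveI := hloc 𝔪 h𝔪
  rw [← vanishingIdeal_compl_regularLocus_of_isLocalization 𝔪.primeCompl hS, Ideal.map_map,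
    ← IsScalarTower.algebraMap_eq R S (Localization.AtPrime 𝔪),
    ← vanishingIdeal_compl_regularLocus_of_isLocalization
      (𝔪.comap (algebraMap R S)).primeCompl hR]

/-! ## Affine opens `V ⊆ U`: local rings of `Γ(X, V)` are local rings of `Γ(X, U)` -/

/-- **The local rings of `Spec Γ(X, V)` are those of `Spec Γ(X, U)`** for affine opens `V ⊆ U`
of a scheme `X`: for a maximal (indeed any prime) ideal `𝔪` of `Γ(X, V)` with corresponding
point `x ∈ V`, both `Γ(X, V)_𝔪` and `Γ(X, U)_{res⁻¹ 𝔪}` are the stalk `𝒪_{X, x}`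
(`IsAffineOpen.isLocalization_stalk'`, `IsAffineOpen.isLocalization_stalk`), compatibly with
the restriction map (`germ_res`), and `res⁻¹ 𝔪` is the prime of `x` in `Γ(X, U)` since both are
the contraction of the maximal ideal of the stalk.
[cite: Hartshorne1977, II Prop. 2.2 and Ex. 2.16] -/
theorem affineRes_isLocalization {X : Scheme.{u}} {U V : X.Opens} (hU : IsAffineOpen U)
    (hV : IsAffineOpen V) (hVU : V ≤ U) [Algebra Γ(X, U) Γ(X, V)]
    (halg : algebraMap Γ(X, U) Γ(X, V) = (X.presheaf.map (homOfLE hVU).op).hom)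
    (𝔪 : Ideal Γ(X, V)) [𝔪.IsMaximal] :
    IsLocalization (𝔪.comap (algebraMap Γ(X, U) Γ(X, V))).primeCompl
      (Localization.AtPrime 𝔪) := by
  let y : PrimeSpectrum Γ(X, V) := ⟨𝔪, inferInstance⟩
  have hyV : hV.fromSpec y ∈ V := hV.range_fromSpec.le ⟨y, rfl⟩
  have hyU : hV.fromSpec y ∈ U := hVU hyV
  letI algV : Algebra Γ(X, V) (X.presheaf.stalk (hV.fromSpec y)) :=
    TopCat.Presheaf.algebra_section_stalk X.presheaf ⟨hV.fromSpec y, hyV⟩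
  haveI locV : IsLocalization.AtPrime (X.presheaf.stalk (hV.fromSpec y)) y.asIdeal :=
    hV.isLocalization_stalk' y hyV
  letI algU : Algebra Γ(X, U) (X.presheaf.stalk (hV.fromSpec y)) :=
    TopCat.Presheaf.algebra_section_stalk X.presheaf ⟨hV.fromSpec y, hyU⟩
  haveI locU : IsLocalization.AtPrime (X.presheaf.stalk (hV.fromSpec y))
      (hU.primeIdealOf ⟨hV.fromSpec y, hyU⟩).asIdeal :=
    hU.isLocalization_stalk ⟨hV.fromSpec y, hyU⟩
  haveI tower : IsScalarTower Γ(X, U) Γ(X, V) (X.presheaf.stalk (hV.fromSpec y)) :=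
    IsScalarTower.of_algebraMap_eq fun r => by
      rw [halg]
      exact (TopCat.Presheaf.germ_res_apply X.presheaf (homOfLE hVU) _ hyV r).symm
  -- the prime of `x` in `Γ(X, U)` is `res⁻¹ 𝔪`
  have hp : (hU.primeIdealOf ⟨hV.fromSpec y, hyU⟩).asIdeal =
      𝔪.comap (algebraMap Γ(X, U) Γ(X, V)) := by
    rw [← IsLocalization.AtPrime.under_maximalIdeal (X.presheaf.stalk (hV.fromSpec y))
        (hU.primeIdealOf ⟨hV.fromSpec y, hyU⟩).asIdeal,
      Ideal.under, IsScalarTower.algebraMap_eq Γ(X, U) Γ(X, V) (X.presheaf.stalk _),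
      ← Ideal.comap_comap]
    congr 1
    exact IsLocalization.AtPrime.under_maximalIdeal (X.presheaf.stalk (hV.fromSpec y)) y.asIdeal
  -- transport the `Γ(X, U)`-localisation structure of the stalk to `Γ(X, V)_𝔪`
  let e : X.presheaf.stalk (hV.fromSpec y) ≃ₐ[Γ(X, V)] Localization.AtPrime 𝔪 :=
    IsLocalization.algEquiv 𝔪.primeCompl _ _
  have key : ∀ {p q : Ideal Γ(X, U)} [p.IsPrime] [q.IsPrime], p = q →
      IsLocalization p.primeCompl (Localization.AtPrime 𝔪) →
      IsLocalization q.primeCompl (Localization.AtPrime 𝔪) := by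
    rintro p q _ _ rfl h
    exact h
  exact key hp (IsLocalization.isLocalization_of_algEquiv _ (e.restrictScalars Γ(X, U)))

/-! ## The registered stub -/

section Stub

variable {k K : Type} [Field k] [Field K] [Algebra k K]

/-- The regular locus of the coordinate ring of an affine open of a proper model is open: it is
the preimage of the (open: `M.X` is of finite type over the field `k`, Matsumura Cor. to
Thm. 30.5 globalised, `isOpen_regularLocus_of_locallyOfFiniteType_field`) regular locus of `M.X`
under `Spec Γ(M, U) ↪ M.X`. [cite: Matsumura1987, §30 Cor. to Thm. 30.5] -/
theorem affineRes_isOpen_regularLocus (M : ProperModel k K) {U : M.X.Opens}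
    (hU : IsAffineOpen U) : IsOpen (regularLocus Γ(M.X, U)) := by
  rw [← fromSpec_preimage_regularLocus hU]
  exact (isOpen_regularLocus_of_locallyOfFiniteType_field M.π).preimage hU.fromSpec.continuous

/-- The restriction map of a scheme between affine opens `V ⊆ U` is flat: it is
`(𝟙 X).appLE U V`, and the identity is an open immersion, hence flat (`Flat.flat_appLE`).
[cite: Hartshorne1977, III Prop. 9.2] -/
theorem affineRes_flat {X : Scheme.{u}} {U V : X.Opens} (hU : IsAffineOpen U)
    (hV : IsAffineOpen V) (hVU : V ≤ U) : (X.presheaf.map (homOfLE hVU).op).hom.Flat := by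
  -- `(𝟙 X).appLE U V _ = 𝟙 _ ≫ X.presheaf.map (homOfLE _).op` is definitionally `res`
  exact Flat.flat_appLE (𝟙 X) hU hV (show V ≤ (𝟙 X) ⁻¹ᵁ U from hVU)

/-- **STUB `stub_affineRes`.** For non-empty affine opens `V ⊆ U` of a proper model the
restriction map `Γ(M, U) → Γ(M, V)` is injective (`M` integral), flat (an open immersion of
affine schemes), and carries the ideal of the non-regular locus of `Γ(M,U)` onto that of
`Γ(M,V)` (the local rings of `Spec Γ(M,V)` are those of `Spec Γ(M,U)` at the image points —
both are stalks of `M` —, the regular loci are open, and the ideal of the non-regular locus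
localises). [cite: Matsumura1987, §30 Cor. to Thm. 30.5] -/
theorem stub_affineRes : ∀ (k K : Type) [Field k] [Field K] [Algebra k K]
    (M : ProperModel k K) (U V : M.X.Opens) (_hU : IsAffineOpen U) (_hV : IsAffineOpen V) (hVU : V ≤ U),
      ((V : Set M.X).Nonempty) →
      Function.Injective (M.X.presheaf.map (homOfLE hVU).op).hom ∧
      (M.X.presheaf.map (homOfLE hVU).op).hom.Flat ∧
      sInf ((fun 𝔭 : PrimeSpectrum Γ(M.X, V) => 𝔭.asIdeal) ''
          {𝔭 : PrimeSpectrum Γ(M.X, V) | ¬ IsRegularLocalRing (Localization.AtPrime 𝔭.asIdeal)}) =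
        (sInf ((fun 𝔭 : PrimeSpectrum Γ(M.X, U) => 𝔭.asIdeal) ''
          {𝔭 : PrimeSpectrum Γ(M.X, U) | ¬ IsRegularLocalRing (Localization.AtPrime 𝔭.asIdeal)})).map
          (M.X.presheaf.map (homOfLE hVU).op).hom := by
  intro k K _ _ _ M U V hU hV hVU hne
  refine ⟨?_, affineRes_flat hU hV hVU, ?_⟩
  · haveI : Nonempty V := by
      obtain ⟨x, hx⟩ := hne
      exact ⟨⟨x, hx⟩⟩
    exact map_injective_of_isIntegral M.X (homOfLE hVU)
  · letI : Algebra Γ(M.X, U) Γ(M.X, V) := (M.X.presheaf.map (homOfLE hVU).op).hom.toAlgebra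
    rw [affineRes_sInf_eq_vanishingIdeal, affineRes_sInf_eq_vanishingIdeal]
    exact affineRes_vanishingIdeal_eq_map
      (isClosed_compl_iff.mpr (affineRes_isOpen_regularLocus M hU))
      (isClosed_compl_iff.mpr (affineRes_isOpen_regularLocus M hV))
      (fun 𝔪 _ => affineRes_isLocalization hU hV hVU rfl 𝔪)

end Stub

end Summit.ResolutionOfSingularities.ResolutionOfSingularities.Theorems.SyzygyFlattening

end
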